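import Mathlib
import HarnessLib
import Summits.AtomisticToContinuum.BoseEinsteinCondensation.Theorems.BlockLatticeFSumKinematics
import Summits.AtomisticToContinuum.BoseEinsteinCondensation.Theorems.BlockLatticeFSumBessel
import Summits.AtomisticToContinuum.BoseEinsteinCondensation.Theorems.BlockLatticeFSumPlancherel
import Literature.MathematicalPhysics.QuantumManyBody.PeriodicBoseGasUpperBoundProofs
import Literature.Barriers.AtomisticToContinuum.KineticGapLengthScalesFreeGas
import Literature.MathematicalPhysics.QuantumManyBody.BoseGasThermodynamicLimitRuelle
import Literature.MathematicalPhysics.QuantumManyBody.BoseGasStructureFactor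

/-!
(TREE TWIN of `run/shared/lean/pub/decomp-a2c/decomp-a2c-lens-6/g25/LinearResponseGainFree.lean`, namespace moved under `Theorems`; no `def`s;
THESES-FREE (critic row 364 (2)): imports neither the route file nor a module importing it — `eps_pos` re-proved without the
ResponseComposition lattice lemmas; for landing as
`Theorems/DeepInfraredEmptinessGainFree.lean --supports stmt-AtomisticToContinuum-27506`.)
 # BlockLatticeFSum · residual `DeepInfraredEmptiness` (stmt-AtomisticToContinuum-27506) — the MODEL THEOREM of piece B
# `LinearResponseGain` in the FREE GAS (`a = 0`)   (decomp-a2c lens-6 «barrier-complement carving», generation 25; critic row 350 (4)(b))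

**What is proved (0 sorry).**  For an admissible `v` with `scatteringLength v = 0`:

* `blockWave_occupation_le_free` — the core estimate: for `N ≥ 2`, `2R₀ < L`, every periodic trial state `Ψ` and every
  block wave `f_q` with `q ≢ 0`:  `n(f_q) + n₀ ≤ N ≤ n₀ + C_P L² ⟨Ψ,HΨ⟩`, hence `n(f_q) ≤ C_P L² · ⟨Ψ, HΨ⟩`
  (block Parseval `Σ_q n(f_q) = Σ_B n(u_B) ≤ N` of the route's kinematics, `f_0 · 1_cell = constantMode`, the torus Poincaré
  depletion bound `natCast_le_condensateOccupation_add`, and `E₀^per = 0` for `a = 0`);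
* `linearResponseGain_free_allConstants` — **B holds in the free gas for EVERY block scale `A > 0`, EVERY shell depth `θ > 0`
  and EVERY constant `C > 0`** (even without the gain factor `1 + S/N ≥ 1` and without the window / parity hypotheses):
  with `δ_N := C/(6 C_P L_N²)` every `δ_N`-near-minimiser has `n(f_q) ≤ C/6 ≤ C/ε(q)` on every `q ≢ 0` (`0 < ε(q) ≤ 6`);
* `linearResponseGain_free` — B's registered text (`stub_linearResponseGain` of skeleton d1b2e876 on stmt-27506) restricted to
  `a = 0`, and `deepPointwiseOne_free` — the same for DP1 (v2's `stub_deepPointwiseOne` text).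

**What it shows about B (the critic's question «non-vacuity + the shape of the constants A, θ»).**  At `a = 0` the statement is
NON-VACUOUS (near-minimisers exist, `δ_N > 0` explicit) and carries NO constraint on `(A, θ, C)`: all of B's content sits at
`a > 0`, where `E₀^per > 0` and the slack `δ_N` can no longer be spent against the spectral gap `~ L⁻²` of the free torus.
The free mechanism (depletion `≤ C_P L² · (E − E₀)`) is exactly the one the barrier `KineticGapLengthScales` certifies as
exhausted at `a > 0` (`E₀ ~ 4πaρN ≫ L⁻²`): the missing input for B at `a > 0` is a STATIC-RESPONSE / infrared bound for
`H + λ·(one-body perturbation at block momentum k)` at LHY precision (`χ(k) ≤ C/(ρa)`-type, cf. 9093's why-might-fail), not an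
energy asymptotics.  (Typed attack memo: NODE-PlaneWaveCarving.md §B.) -/

noncomputable section

namespace Summit.AtomisticToContinuum.BoseEinsteinCondensation.Theorems.DeepInfraredEmptinessGainFree

open Filter MeasureTheory
open scoped ENNReal
open Literature.MathematicalPhysics.QuantumManyBody.BoseGas
open Summit.AtomisticToContinuum.BoseEinsteinCondensation.Theses.BlockLatticeFSum

variable {K : ℕ} {L : ℝ}

/-! ## Lattice facts: `0 < ε(q) ≤ 6` for `q ≢ 0` -/

/-- `ε(q) ≤ 6`. [folklore] -/
theorem eps_le_six (K : ℕ) (q : Fin 3 → Fin K) :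
    (∑ j : Fin 3, (1 - Real.cos (2 * Real.pi * ((q j : ℕ) : ℝ) / (K : ℝ)))) ≤ 6 := by
  have h : ∀ j ∈ (Finset.univ : Finset (Fin 3)),
      (1 - Real.cos (2 * Real.pi * ((q j : ℕ) : ℝ) / (K : ℝ))) ≤ 2 := fun j _ => by
    linarith [Real.neg_one_le_cos (2 * Real.pi * ((q j : ℕ) : ℝ) / (K : ℝ))]
  calc (∑ j : Fin 3, (1 - Real.cos (2 * Real.pi * ((q j : ℕ) : ℝ) / (K : ℝ))))
      ≤ ∑ _j : Fin 3, (2 : ℝ) := Finset.sum_le_sum h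
    _ = 6 := by norm_num

/-- `0 < ε(q)` for `q ≢ 0` (`cos(2πq_j/K) < 1` for `0 < q_j < K`). [folklore] -/
theorem eps_pos (hK : 0 < K) (q : Fin 3 → Fin K) (hq : ¬ (∀ j : Fin 3, (q j : ℕ) = 0)) :
    0 < (∑ j : Fin 3, (1 - Real.cos (2 * Real.pi * ((q j : ℕ) : ℝ) / (K : ℝ)))) := by
  push Not at hq
  obtain ⟨j, hj⟩ := hq
  have hKr : (0 : ℝ) < K := Nat.cast_pos.2 hK
  have hqK : ((q j : ℕ) : ℝ) < K := by exact_mod_cast (q j).isLt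
  have hq0 : (0 : ℝ) < ((q j : ℕ) : ℝ) := by exact_mod_cast Nat.pos_of_ne_zero hj
  have hx0 : 0 < 2 * Real.pi * ((q j : ℕ) : ℝ) / (K : ℝ) := by positivity
  have hx2 : 2 * Real.pi * ((q j : ℕ) : ℝ) / (K : ℝ) < 2 * Real.pi := by
    rw [div_lt_iff₀ hKr]
    nlinarith [Real.pi_pos]
  have hcos : Real.cos (2 * Real.pi * ((q j : ℕ) : ℝ) / (K : ℝ)) < 1 := by
    refine lt_of_le_of_ne (Real.cos_le_one _) fun h => ?_
    have h0 := (Real.cos_eq_one_iff_of_lt_of_lt (by linarith [Real.pi_pos]) hx2).1 h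
    linarith
  exact lt_of_lt_of_le (sub_pos.2 hcos)
    (Finset.single_le_sum (f := fun i : Fin 3 => 1 - Real.cos (2 * Real.pi * ((q i : ℕ) : ℝ) / (K : ℝ)))
      (fun i _ => sub_nonneg.2 (Real.cos_le_one _)) (Finset.mem_univ j))

/-! ## The zero block wave is the condensate mode -/

/-- the block wave with index `q = 0` is the constant `L^{-3/2}`. [folklore] -/
theorem blockWave_zero (hK : 0 < K) (L : ℝ) :
    (fun x : EuclideanSpace ℝ (Fin 3) => (((Real.sqrt (L ^ 3))⁻¹ : ℝ) : ℂ) * Complex.exp (((2 * Real.pi * (∑ j : Fin 3, (((fun _ : Fin 3 => (⟨0, hK⟩ : Fin K)) j : ℕ) : ℝ) * (⌊(K : ℝ) * x j / L⌋ : ℝ)) / (K : ℝ) : ℝ) : ℂ) * Complex.I))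
      = fun _ => (((Real.sqrt (L ^ 3))⁻¹ : ℝ) : ℂ) := by
  funext x
  simp

/-- occupation of the constant `L^{-3/2}` = Fournais's condensate occupation. [folklore] -/
theorem cellOccupation_const_eq_condensateOccupation (N : ℕ) (L : ℝ) (Ψ : (Fin N → EuclideanSpace ℝ (Fin 3)) → ℂ) :
    cellOccupation N L (fun _ => (((Real.sqrt (L ^ 3))⁻¹ : ℝ) : ℂ)) Ψ = condensateOccupation N L Ψ := by
  simp only [cellOccupation, condensateOccupation, constantMode, Complex.ofReal_inv]

/-! ## `E₀^per = 0` at `a = 0` (the `a = 0` case of the proved LSSY periodic upper bound) -/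

/-! ## Core estimate: in ANY state, a non-zero block wave carries at most the depletion -/

/-- `n(f_q) + n₀ ≤ N` for `q ≢ 0` (block Parseval + Bessel for the block modes). [folklore] -/
theorem blockWave_occupation_add_condensate_le {N : ℕ} (hN : 0 < N) (hK : 0 < K) (hL : 0 < L)
    (Ψ : PeriodicTrialState N L) (q : Fin 3 → Fin K) (hq : ¬ (∀ j : Fin 3, (q j : ℕ) = 0)) :
    cellOccupation N L (fun x : EuclideanSpace ℝ (Fin 3) => (((Real.sqrt (L ^ 3))⁻¹ : ℝ) : ℂ) * Complex.exp (((2 * Real.pi * (∑ j : Fin 3, ((q j : ℕ) : ℝ) * (⌊(K : ℝ) * x j / L⌋ : ℝ)) / (K : ℝ) : ℝ) : ℂ) * Complex.I)) Ψ.ψ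
      + condensateOccupation N L Ψ.ψ ≤ (N : ℝ≥0∞) := by
  classical
  set z : Fin 3 → Fin K := fun _ => ⟨0, hK⟩ with hz
  have hqz : q ≠ z := by
    intro h
    apply hq
    intro j
    rw [h]
  -- the sum over all block waves dominates the two-element sum {q, z}
  have hpar := Kinematics.parseval_blockWaves_trialState (K := K) hN hK hL Ψ
  have hbes := Bessel.sum_cellOccupation_blockMode_le_card (K := K) hN hK hL Ψ
  have hzocc : cellOccupation N L (fun x : EuclideanSpace ℝ (Fin 3) => (((Real.sqrt (L ^ 3))⁻¹ : ℝ) : ℂ) * Complex.exp (((2 * Real.pi * (∑ j : Fin 3, ((z j : ℕ) : ℝ) * (⌊(K : ℝ) * x j / L⌋ : ℝ)) / (K : ℝ) : ℝ) : ℂ) * Complex.I)) Ψ.ψ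
      = condensateOccupation N L Ψ.ψ := by
    rw [hz, blockWave_zero hK L, cellOccupation_const_eq_condensateOccupation]
  have hsub : ({q, z} : Finset (Fin 3 → Fin K)) ⊆ Finset.univ := Finset.subset_univ _
  have htwo := Finset.sum_le_sum_of_subset_of_nonneg hsub (fun i _ _ => (bot_le :
    (0 : ℝ≥0∞) ≤ cellOccupation N L (fun x : EuclideanSpace ℝ (Fin 3) => (((Real.sqrt (L ^ 3))⁻¹ : ℝ) : ℂ) * Complex.exp (((2 * Real.pi * (∑ j : Fin 3, ((i j : ℕ) : ℝ) * (⌊(K : ℝ) * x j / L⌋ : ℝ)) / (K : ℝ) : ℝ) : ℂ) * Complex.I)) Ψ.ψ))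
  rw [Finset.sum_pair hqz] at htwo
  rw [← hzocc]
  exact htwo.trans (hpar.le.trans hbes)

/-- **Free-gas core estimate**: for admissible `v` with `a = 0` there are `R₀` and `C_P > 0` with
`n(f_q) ≤ C_P L² · ⟨Ψ, HΨ⟩` for every `N ≥ 2`, `0 < L`, `2R₀ < L`, every periodic trial state and every `q ≢ 0`
(`E₀^per = 0`, so `⟨Ψ,HΨ⟩` is the excess energy). [folklore; inputs LSSY2005 Thm 2.2 (a = 0) and Lemma 4.1] -/
theorem blockWave_occupation_le_free {v : ℝ → ℝ≥0∞} (hv : IsRepulsiveFiniteRange v) (ha : scatteringLength v = 0) :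
    ∃ R₀ : ℝ, ∃ C_P : ℝ, 0 < C_P ∧ ∀ (N : ℕ) (L : ℝ), 2 ≤ N → 0 < L → 2 * R₀ < L →
      periodicGroundStateEnergy v N L = 0 ∧
      ∀ (Ψ : PeriodicTrialState N L) (K : ℕ), 0 < K → ∀ q : Fin 3 → Fin K, ¬ (∀ j : Fin 3, (q j : ℕ) = 0) →
        cellOccupation N L (fun x : EuclideanSpace ℝ (Fin 3) => (((Real.sqrt (L ^ 3))⁻¹ : ℝ) : ℂ) * Complex.exp (((2 * Real.pi * (∑ j : Fin 3, ((q j : ℕ) : ℝ) * (⌊(K : ℝ) * x j / L⌋ : ℝ)) / (K : ℝ) : ℝ) : ℂ) * Complex.I)) Ψ.ψ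
          ≤ ENNReal.ofReal (C_P * L ^ 2) * periodicEnergy v Ψ := by
  obtain ⟨R₀, hE⟩ : ∃ R₀ : ℝ, ∀ (N : ℕ) (L : ℝ), 2 ≤ N → 0 < L → 2 * R₀ < L →
      periodicGroundStateEnergy v N L = 0 := by
    -- inlined (the tree twin `Theorems.periodicGroundStateEnergy_eq_zero_of_scatteringLength_eq_zero` lives in a Theses-importing module)
    have hvc := hv
    obtain ⟨hmeas, R₀, hR⟩ := hvc
    obtain ⟨C, c, _, hc, h⟩ :=
      LSSY2005_upperBound_periodic_holds v R₀ hmeas hR (by rw [ha]; exact ENNReal.zero_ne_top)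
    refine ⟨R₀, fun N L hN hL hRL => ?_⟩
    have key := h N L hN hL hRL
    simp only [ha, ENNReal.toReal_zero, zero_div, mul_zero, zero_mul, ENNReal.ofReal_zero,
      nonpos_iff_eq_zero] at key
    exact key hc.le
  obtain ⟨C, hC, hdep⟩ := Literature.Barriers.AtomisticToContinuum.BoseGas.natCast_le_condensateOccupation_add
  refine ⟨R₀, C, hC, fun N L hN hL hRL => ⟨hE N L hN hL hRL, fun Ψ K hK q hq => ?_⟩⟩
  have hN0 : 0 < N := by omega
  have h1 := blockWave_occupation_add_condensate_le hN0 hK hL Ψ q hq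
  have h2 := hdep N L (by omega) hL v Ψ
  have hn0 : condensateOccupation N L Ψ.ψ ≠ ⊤ :=
    ne_top_of_le_ne_top (ENNReal.natCast_ne_top N) (le_trans le_add_self h1)
  have h3 := h1.trans h2
  rw [add_comm (condensateOccupation N L Ψ.ψ)] at h3
  exact (ENNReal.add_le_add_iff_right hn0).1 h3

/-! ## B in the free gas: every `A`, every `θ`, every `C` -/

/-- **`LinearResponseGain` at `a = 0` for ALL constants** (no window, parity or gain factor needed): for admissible `v` with
`a = 0`, every `C > 0` and every `ρ > 0`, for all large `N` there is `δ > 0` such that every `δ`-near-minimiser on the torus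
of side `L_N = (N/ρ)^{1/3}` has `n(f_q) ≤ C/ε(q)` on every block wave `q ≢ 0` of every block number `K > 0`. [folklore] -/
theorem blockWave_occupation_le_inv_eps_free {v : ℝ → ℝ≥0∞} (hv : IsRepulsiveFiniteRange v) (ha : scatteringLength v = 0)
    (C : ℝ) (hC : 0 < C) (ρ : ℝ) (hρ : 0 < ρ) :
    ∀ᶠ N : ℕ in Filter.atTop, ∃ δ : ENNReal, 0 < δ ∧ ∀ Ψ : PeriodicTrialState N (sideLength ρ N),
      periodicEnergy v Ψ ≤ periodicGroundStateEnergy v N (sideLength ρ N) + δ →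
      ∀ K : ℕ, 0 < K → ∀ q : Fin 3 → Fin K, ¬ (∀ j : Fin 3, (q j : ℕ) = 0) →
        cellOccupation N (sideLength ρ N) (fun x : EuclideanSpace ℝ (Fin 3) => (((Real.sqrt (sideLength ρ N ^ 3))⁻¹ : ℝ) : ℂ) * Complex.exp (((2 * Real.pi * (∑ j : Fin 3, ((q j : ℕ) : ℝ) * (⌊(K : ℝ) * x j / sideLength ρ N⌋ : ℝ)) / (K : ℝ) : ℝ) : ℂ) * Complex.I)) Ψ.ψ
          ≤ ENNReal.ofReal (C / (∑ j : Fin 3, (1 - Real.cos (2 * Real.pi * ((q j : ℕ) : ℝ) / (K : ℝ))))) := by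
  obtain ⟨R₀, C_P, hCP, H⟩ := blockWave_occupation_le_free hv ha
  filter_upwards [eventually_gt_atTop 1, (tendsto_sideLength_atTop hρ).eventually_gt_atTop (2 * R₀)] with N hN hNR
  have hN0 : 0 < N := lt_trans zero_lt_one hN
  have hL : 0 < sideLength ρ N := sideLength_pos_of_pos hρ hN0
  obtain ⟨hE0, HΨ⟩ := H N (sideLength ρ N) hN hL hNR
  refine ⟨ENNReal.ofReal (C / (6 * (C_P * sideLength ρ N ^ 2))), by rw [ENNReal.ofReal_pos]; positivity, ?_⟩
  intro Ψ hΨ K hK q hq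
  rw [hE0, zero_add] at hΨ
  have hεpos := eps_pos hK q hq
  have hε6 := eps_le_six K q
  have key := HΨ Ψ K hK q hq
  have hCPL : 0 < C_P * sideLength ρ N ^ 2 := by positivity
  calc cellOccupation N (sideLength ρ N) (fun x : EuclideanSpace ℝ (Fin 3) => (((Real.sqrt (sideLength ρ N ^ 3))⁻¹ : ℝ) : ℂ) * Complex.exp (((2 * Real.pi * (∑ j : Fin 3, ((q j : ℕ) : ℝ) * (⌊(K : ℝ) * x j / sideLength ρ N⌋ : ℝ)) / (K : ℝ) : ℝ) : ℂ) * Complex.I)) Ψ.ψ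
      ≤ ENNReal.ofReal (C_P * sideLength ρ N ^ 2) * periodicEnergy v Ψ := key
    _ ≤ ENNReal.ofReal (C_P * sideLength ρ N ^ 2) * ENNReal.ofReal (C / (6 * (C_P * sideLength ρ N ^ 2))) := by
        gcongr
    _ = ENNReal.ofReal (C / 6) := by
        rw [← ENNReal.ofReal_mul hCPL.le]
        congr 1
        field_simp
    _ ≤ ENNReal.ofReal (C / (∑ j : Fin 3, (1 - Real.cos (2 * Real.pi * ((q j : ℕ) : ℝ) / (K : ℝ))))) :=
        ENNReal.ofReal_le_ofReal (div_le_div_of_nonneg_left hC.le hεpos hε6)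

/-- **B (`LinearResponseGain`, registered `stub_linearResponseGain` text) in the free gas, with ALL constants free**:
for admissible `v` with `a = 0` and EVERY `A, θ, C > 0` the body of B holds with `ρ₀ = 1` (any `ρ₀` works).
The shape of the constants in the model: unconstrained — B's content is entirely at `a > 0`. [folklore] -/
theorem linearResponseGain_free_allConstants {v : ℝ → ℝ≥0∞} (hv : IsRepulsiveFiniteRange v)
    (ha : scatteringLength v = 0) (A : ℝ) (θ : ℝ) (C : ℝ) (hC : 0 < C) :
    ∀ ρ : ℝ, 0 < ρ → ∀ᶠ N : ℕ in Filter.atTop, ∃ δ : ENNReal, 0 < δ ∧ ∀ Ψ : Literature.MathematicalPhysics.QuantumManyBody.BoseGas.PeriodicTrialState N (Literature.MathematicalPhysics.QuantumManyBody.BoseGas.sideLength ρ N), Literature.MathematicalPhysics.QuantumManyBody.BoseGas.periodicEnergy v Ψ ≤ Literature.MathematicalPhysics.QuantumManyBody.BoseGas.periodicGroundStateEnergy v N (Literature.MathematicalPhysics.QuantumManyBody.BoseGas.sideLength ρ N) + δ → ∀ K : ℕ, Even K → 0 < K → A / Real.sqrt ρ ≤ Literature.MathematicalPhysics.QuantumManyBody.BoseGas.sideLength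 ρ N / (K : ℝ) ∧ Literature.MathematicalPhysics.QuantumManyBody.BoseGas.sideLength ρ N / (K : ℝ) ≤ 2 * A / Real.sqrt ρ → ∀ q ∈ (Finset.univ.filter fun q : Fin 3 → Fin K => ¬ (∀ j : Fin 3, (q j : ℕ) = 0) ∧ (∑ j : Fin 3, (1 - Real.cos (2 * Real.pi * ((q j : ℕ) : ℝ) / (K : ℝ)))) < θ), Literature.MathematicalPhysics.QuantumManyBody.BoseGas.cellOccupation N (Literature.MathematicalPhysics.QuantumManyBody.BoseGas.sideLength ρ N) (fun x : EuclideanSpace ℝ (Fin 3) => (((Real.sqrt (Literature.MathematicalPhysics.QuantumManyBody.BoseGas.sideLength ρ N ^ 3))⁻¹ : ℝ) : ℂ) * Complex.exp (((2 * Real.pi * (∑ j : Fin 3, ((q j : ℕ) : ℝ) * (⌊(K : ℝ) * x j / Literature.MathematicalPhysics.QuantumManyBody.BoseGas.sideLength ρ N⌋ : ℝ)) / (K : ℝ) : ℝ) : ℂ) * Complex.I)) Ψ.ψ ≤ ENNReal.ofReal (C / (∑ j : Fin 3, (1 - Real.cos (2 * Real.pi * ((q j : ℕ) : ℝ) / (K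 : ℝ))))) * (1 + Literature.MathematicalPhysics.QuantumManyBody.BoseGas.structureFactorVar N (Literature.MathematicalPhysics.QuantumManyBody.BoseGas.sideLength ρ N) ((Literature.MathematicalPhysics.QuantumManyBody.BoseGas.cellN N (Literature.MathematicalPhysics.QuantumManyBody.BoseGas.sideLength ρ N)).indicator Ψ.ψ) (fun j : Fin 3 => if 2 * (q j : ℕ) ≤ K then (((q j : ℕ) : ℤ)) else (((q j : ℕ) : ℤ) - (K : ℤ))) / (N : ENNReal)) := by
  intro ρ hρ
  filter_upwards [blockWave_occupation_le_inv_eps_free hv ha C hC ρ hρ] with N hN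
  obtain ⟨δ, hδ, H⟩ := hN
  refine ⟨δ, hδ, fun Ψ hΨ K _ hK _ q hq => ?_⟩
  rw [Finset.mem_filter] at hq
  calc Literature.MathematicalPhysics.QuantumManyBody.BoseGas.cellOccupation N (Literature.MathematicalPhysics.QuantumManyBody.BoseGas.sideLength ρ N) (fun x : EuclideanSpace ℝ (Fin 3) => (((Real.sqrt (Literature.MathematicalPhysics.QuantumManyBody.BoseGas.sideLength ρ N ^ 3))⁻¹ : ℝ) : ℂ) * Complex.exp (((2 * Real.pi * (∑ j : Fin 3, ((q j : ℕ) : ℝ) * (⌊(K : ℝ) * x j / Literature.MathematicalPhysics.QuantumManyBody.BoseGas.sideLength ρ N⌋ : ℝ)) / (K : ℝ) : ℝ) : ℂ) * Complex.I)) Ψ.ψ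
      ≤ ENNReal.ofReal (C / (∑ j : Fin 3, (1 - Real.cos (2 * Real.pi * ((q j : ℕ) : ℝ) / (K : ℝ))))) := H Ψ hΨ K hK q hq.2.1
    _ = ENNReal.ofReal (C / (∑ j : Fin 3, (1 - Real.cos (2 * Real.pi * ((q j : ℕ) : ℝ) / (K : ℝ))))) * 1 := (mul_one _).symm
    _ ≤ ENNReal.ofReal (C / (∑ j : Fin 3, (1 - Real.cos (2 * Real.pi * ((q j : ℕ) : ℝ) / (K : ℝ))))) * (1 + Literature.MathematicalPhysics.QuantumManyBody.BoseGas.structureFactorVar N (Literature.MathematicalPhysics.QuantumManyBody.BoseGas.sideLength ρ N) ((Literature.MathematicalPhysics.QuantumManyBody.BoseGas.cellN N (Literature.MathematicalPhysics.QuantumManyBody.BoseGas.sideLength ρ N)).indicator Ψ.ψ) (fun j : Fin 3 => if 2 * (q j : ℕ) ≤ K then (((q j : ℕ) : ℤ)) else (((q j : ℕ) : ℤ) - (K : ℤ))) / (N : ENNReal)) :=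
        by gcongr; exact le_self_add

/-- **B's registered text restricted to the free gas** (`stub_linearResponseGain` of skeleton d1b2e876 on stmt-27506 with the extra
hypothesis `scatteringLength v = 0`; constants `A = θ = C = ρ₀ = 1`). [folklore] -/
theorem linearResponseGain_free :
    ∀ v : ℝ → ENNReal, Literature.MathematicalPhysics.QuantumManyBody.BoseGas.IsRepulsiveFiniteRange v → Literature.MathematicalPhysics.QuantumManyBody.BoseGas.scatteringLength v = 0 → ∃ A : ℝ, 0 < A ∧ ∃ θ : ℝ, 0 < θ ∧ ∃ C : ℝ, 0 < C ∧ ∃ ρ₀ : ℝ, 0 < ρ₀ ∧ ∀ ρ : ℝ, 0 < ρ → ρ < ρ₀ → ∀ᶠ N : ℕ in Filter.atTop, ∃ δ : ENNReal, 0 < δ ∧ ∀ Ψ : Literature.MathematicalPhysics.QuantumManyBody.BoseGas.PeriodicTrialState N (Literature.MathematicalPhysics.QuantumManyBody.BoseGas.sideLength ρ N), Literature.MathematicalPhysics.QuantumManyBody.BoseGas.periodicEnergy v Ψ ≤ Literature.MathematicalPhysics.QuantumManyBody.BoseGas.periodicGroundStateEnergy v N (Literature.MathematicalPhysics.QuantumManyBody.BoseGas.sideLength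 ρ N) + δ → ∀ K : ℕ, Even K → 0 < K → A / Real.sqrt ρ ≤ Literature.MathematicalPhysics.QuantumManyBody.BoseGas.sideLength ρ N / (K : ℝ) ∧ Literature.MathematicalPhysics.QuantumManyBody.BoseGas.sideLength ρ N / (K : ℝ) ≤ 2 * A / Real.sqrt ρ → ∀ q ∈ (Finset.univ.filter fun q : Fin 3 → Fin K => ¬ (∀ j : Fin 3, (q j : ℕ) = 0) ∧ (∑ j : Fin 3, (1 - Real.cos (2 * Real.pi * ((q j : ℕ) : ℝ) / (K : ℝ)))) < θ), Literature.MathematicalPhysics.QuantumManyBody.BoseGas.cellOccupation N (Literature.MathematicalPhysics.QuantumManyBody.BoseGas.sideLength ρ N) (fun x : EuclideanSpace ℝ (Fin 3) => (((Real.sqrt (Literature.MathematicalPhysics.QuantumManyBody.BoseGas.sideLength ρ N ^ 3))⁻¹ : ℝ) : ℂ) * Complex.exp (((2 * Real.pi * (∑ j : Fin 3, ((q j : ℕ) : ℝ) * (⌊(K : ℝ) * x j / Literature.MathematicalPhysics.QuantumManyBody.BoseGas.sideLength ρ N⌋ : ℝ)) / (K : ℝ) : ℝ) : ℂ) * Complex.I))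 Ψ.ψ ≤ ENNReal.ofReal (C / (∑ j : Fin 3, (1 - Real.cos (2 * Real.pi * ((q j : ℕ) : ℝ) / (K : ℝ))))) * (1 + Literature.MathematicalPhysics.QuantumManyBody.BoseGas.structureFactorVar N (Literature.MathematicalPhysics.QuantumManyBody.BoseGas.sideLength ρ N) ((Literature.MathematicalPhysics.QuantumManyBody.BoseGas.cellN N (Literature.MathematicalPhysics.QuantumManyBody.BoseGas.sideLength ρ N)).indicator Ψ.ψ) (fun j : Fin 3 => if 2 * (q j : ℕ) ≤ K then (((q j : ℕ) : ℤ)) else (((q j : ℕ) : ℤ) - (K : ℤ))) / (N : ENNReal)) := by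
  intro v hv ha
  exact ⟨1, one_pos, 1, one_pos, 1, one_pos, 1, one_pos, fun ρ hρ _ =>
    linearResponseGain_free_allConstants hv ha 1 1 1 one_pos ρ hρ⟩

/-- **DP1's registered text (v2 `stub_deepPointwiseOne`) restricted to the free gas**, same constants. [folklore] -/
theorem deepPointwiseOne_free :
    ∀ v : ℝ → ENNReal, Literature.MathematicalPhysics.QuantumManyBody.BoseGas.IsRepulsiveFiniteRange v → Literature.MathematicalPhysics.QuantumManyBody.BoseGas.scatteringLength v = 0 → ∃ A : ℝ, 0 < A ∧ ∃ θ : ℝ, 0 < θ ∧ ∃ C : ℝ, 0 < C ∧ ∃ ρ₀ : ℝ, 0 < ρ₀ ∧ ∀ ρ : ℝ, 0 < ρ → ρ < ρ₀ → ∀ᶠ N : ℕ in Filter.atTop, ∃ δ : ENNReal, 0 < δ ∧ ∀ Ψ : Literature.MathematicalPhysics.QuantumManyBody.BoseGas.PeriodicTrialState N (Literature.MathematicalPhysics.QuantumManyBody.BoseGas.sideLength ρ N), Literature.MathematicalPhysics.QuantumManyBody.BoseGas.periodicEnergy v Ψ ≤ Literature.MathematicalPhysics.QuantumManyBody.BoseGas.periodicGroundStateEnergy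 v N (Literature.MathematicalPhysics.QuantumManyBody.BoseGas.sideLength ρ N) + δ → ∀ K : ℕ, Even K → 0 < K → A / Real.sqrt ρ ≤ Literature.MathematicalPhysics.QuantumManyBody.BoseGas.sideLength ρ N / (K : ℝ) ∧ Literature.MathematicalPhysics.QuantumManyBody.BoseGas.sideLength ρ N / (K : ℝ) ≤ 2 * A / Real.sqrt ρ → ∀ q ∈ (Finset.univ.filter fun q : Fin 3 → Fin K => ¬ (∀ j : Fin 3, (q j : ℕ) = 0) ∧ (∑ j : Fin 3, (1 - Real.cos (2 * Real.pi * ((q j : ℕ) : ℝ) / (K : ℝ)))) < θ), Literature.MathematicalPhysics.QuantumManyBody.BoseGas.cellOccupation N (Literature.MathematicalPhysics.QuantumManyBody.BoseGas.sideLength ρ N) (fun x : EuclideanSpace ℝ (Fin 3) => (((Real.sqrt (Literature.MathematicalPhysics.QuantumManyBody.BoseGas.sideLength ρ N ^ 3))⁻¹ : ℝ) : ℂ) * Complex.exp (((2 * Real.pi * (∑ j : Fin 3, ((q j : ℕ) : ℝ) * (⌊(K : ℝ) * x j / Literature.MathematicalPhysics.QuantumManyBody.BoseGas.sideLength ρ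 N⌋ : ℝ)) / (K : ℝ) : ℝ) : ℂ) * Complex.I)) Ψ.ψ ≤ ENNReal.ofReal (C / (∑ j : Fin 3, (1 - Real.cos (2 * Real.pi * ((q j : ℕ) : ℝ) / (K : ℝ))))) := by
  intro v hv ha
  refine ⟨1, one_pos, 1, one_pos, 1, one_pos, 1, one_pos, fun ρ hρ _ => ?_⟩
  filter_upwards [blockWave_occupation_le_inv_eps_free hv ha 1 one_pos ρ hρ] with N hN
  obtain ⟨δ, hδ, H⟩ := hN
  refine ⟨δ, hδ, fun Ψ hΨ K _ hK _ q hq => ?_⟩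
  rw [Finset.mem_filter] at hq
  exact H Ψ hΨ K hK q hq.2.1

end Summit.AtomisticToContinuum.BoseEinsteinCondensation.Theorems.DeepInfraredEmptinessGainFree

end
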